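import Summits.QuantumFields.GaugeBoot.FluctuationVanishing
import HarnessLib

/-!
# Fluctuations of Wilson loops, XVII: the leading-order equation with its pair source (gauge-boot, ADDENDUM 33 part C)

HONEST FRAMING (cell `pub-gaugeboot`, page 1 of every file): the venture produces certified bounds
on lattice expectations at stated coupling, gauge group, dimension and torus size; NOT a mass gap,
NOT a continuum limit, NOT a string tension; NOT Yang–Mills-summit-bearing (barriers
`FixedCouplingUltralocality`, `PerturbativeInvisibility`).  Strong-coupling `SO(N)` lattice gauge theory with free boundary
condition (S. Chatterjee, Comm. Math. Phys. **366** (2019); S. Chatterjee, J. Jafarov, arXiv:1604.04777); nothing about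
four-dimensional continuum Yang–Mills or a mass gap.

## Content

In the setting of `centered_coeff_vanish`: (1) `centered_coeff_nil_mem` — an empty centered block kills every coefficient up to
order `K`; (2) ★ `centered_coeff_leading_equation` — at order `k = m =` (number of centered blocks) the coefficient equation
(`centered_equation_coeff`) collapses, by `centered_coeff_vanish`, to the FIRST-ORDER block equation for the leading
coefficients `u_m(B₀; C₁..C_m) = coeff_m G(B₀; C₁..C_m)` with the PAIR SOURCE
`Σ_{j<j'} u_{m-2}(B₀; blocks without j, j') · x(C_j, C_{j'})`, `x(A, B) := XM A B f₀` (the cross mergers of two centered blocks,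
weighted by the leading coefficient of the fused loop sequence); (3) `centered_two_block_identity` — the case `m = 2`, `B₀ = ∅`:
`(|A| + |B|) κ̃(A, B) − 𝕊𝔻_A κ̃(·, B) − 𝕊𝔻_B κ̃(A, ·) = x(A, B)` for the limiting block covariance `κ̃(A, B) = coeff₂ G(∅; A, B)`.

Everything here is `[new (lane)]` over the cited expansion.
-/

noncomputable section

open Finset Filter Topology PowerSeries
open Literature.MathematicalPhysics.QuantumFieldTheory.Chatterjee2019LargeN
open Literature.MathematicalPhysics.QuantumFieldTheory.Chatterjee2019LargeN.Word

namespace Summit.QuantumFields.GaugeBoot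

namespace StringDuality

variable {d : ℕ}

/-- An empty centered block kills every coefficient up to order `K` (since `coeff_k P(∅) = δ_{k0}` for `k ≤ K`).
[new (lane)] -/
theorem centered_coeff_nil_mem {β : ℝ} {K : ℕ} {F : ℕ → ℝ → LoopSeq d → ℝ}
    (hnil : ∀ k, k ≤ K → F (k + 2) β [] = if k = 0 then 1 else 0)
    (P : LoopSeq d → PowerSeries ℝ) (hP : ∀ (u : LoopSeq d) (k : ℕ), coeff k (P u) = F (k + 2) β u)
    {G : LoopSeq d → List (LoopSeq d) → PowerSeries ℝ}
    (hGs : ∀ (B₀ C : LoopSeq d) (rest : List (LoopSeq d)), G B₀ (C :: rest) = G (B₀ ++ C) rest - P C * G B₀ rest) :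
    ∀ (Cs : List (LoopSeq d)), [] ∈ Cs → ∀ (B₀ : LoopSeq d), ∀ k, k ≤ K → coeff k (G B₀ Cs) = 0 := by
  intro Cs
  induction Cs with
  | nil => intro h; simp at h
  | cons C rest ih =>
    intro hmem B₀ k hk
    rw [hGs, map_sub, PowerSeries.coeff_mul]
    by_cases hC : C = []
    · subst hC
      rw [List.append_nil, Finset.sum_eq_single (0, k)]
      · rw [hP, hnil 0 (Nat.zero_le K), if_pos rfl, one_mul, sub_self]
      · intro q hq hne
        have hq' : q.1 + q.2 = k := Finset.HasAntidiagonal.mem_antidiagonal.mp hq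
        have hq1 : q.1 ≠ 0 := fun h => hne (by ext <;> simp <;> omega)
        rw [hP, hnil q.1 (by omega), if_neg hq1, zero_mul]
      · intro h; exact absurd (Finset.HasAntidiagonal.mem_antidiagonal.mpr (by simp)) h
    · have hrest : [] ∈ rest := by
        rcases List.mem_cons.mp hmem with h | h
        · exact absurd h.symm hC
        · exact h
      rw [ih hrest (B₀ ++ C) k hk, Finset.sum_eq_zero fun q hq => ?_, sub_zero]
      have hq' : q.1 + q.2 = k := Finset.HasAntidiagonal.mem_antidiagonal.mp hq
      rw [ih hrest B₀ q.2 (by omega), mul_zero]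

/-- A sum over the positions of a two-element list. [folklore] -/
theorem sum_fin_pair {α M : Type*} [AddCommMonoid M] (A B : α) (f : Fin [A, B].length → M) :
    ∑ x, f x = f ⟨0, by simp⟩ + f ⟨1, by simp⟩ := by
  exact Fin.sum_univ_two f

section setting

variable {β : ℝ} {K : ℕ} {F : ℕ → ℝ → LoopSeq d → ℝ} {Cc Lc : ℝ} (hCc : 1 ≤ Cc) (hLc : 1 ≤ Lc)
  (hF0 : ∀ u : LoopSeq d, F 0 β u = 0) (hF1 : ∀ u : LoopSeq d, F 1 β u = 0)
  (hrec : ∀ k, k ≤ K → ∀ s : LoopSeq d, IsLoopSeq s → s ≠ [] →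
    (s.len : ℝ) * F (k + 2) β s -
        ((∑ o : InvIdx s, F (k + 2) β (s.negSplitAt o)) - (∑ o : SameIdx s, F (k + 2) β (s.posSplitAt o))
          + β * (∑ o : DeformIdx s, F (k + 2) β (s.negDeformAt o))
          - β * (∑ o : DeformIdx s, F (k + 2) β (s.posDeformAt o))) =
      (s.len : ℝ) * F (k + 1) β s
        + ((∑ o : SameIdx s, F (k + 1) β (s.negTwistAt o)) - ∑ o : InvIdx s, F (k + 1) β (s.posTwistAt o))
        + ((∑ o : MergeIdx s, F k β (s.negMergeAt o)) - ∑ o : MergeIdx s, F k β (s.posMergeAt o)))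
  (hperm : ∀ k, k ≤ K → ∀ s s' : LoopSeq d, IsLoopSeq s → s.Perm s' → F (k + 2) β s = F (k + 2) β s')
  (hnil : ∀ k, k ≤ K → F (k + 2) β [] = if k = 0 then 1 else 0)
  (hbd : ∀ j, j ≤ K → ∀ u : LoopSeq d, IsLoopSeq u → |F (j + 2) β u| ≤ Cc * Lc ^ u.len)
  (hβ : |β| ≤ 1 / (4096 * ((d : ℝ) + 1) * (((1 + (K + 1) * Cc) * Lc) ^ 2 + 4) ^ 4))
  (P : LoopSeq d → PowerSeries ℝ) (hP : ∀ (u : LoopSeq d) (k : ℕ), coeff k (P u) = F (k + 2) β u)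
  {G : LoopSeq d → List (LoopSeq d) → PowerSeries ℝ} (hG0 : ∀ B₀ : LoopSeq d, G B₀ [] = P B₀)
  (hGs : ∀ (B₀ C : LoopSeq d) (rest : List (LoopSeq d)), G B₀ (C :: rest) = G (B₀ ++ C) rest - P C * G B₀ rest)
  (SD : LoopSeq d → (LoopSeq d → ℝ) → ℝ) (XM : LoopSeq d → LoopSeq d → (LoopSeq d → ℝ) → ℝ)
  (hSD : ∀ (A : LoopSeq d) (g : LoopSeq d → ℝ), SD A g =
    ((∑ o : InvIdx A, g (A.negSplitAt o)) - ∑ o : SameIdx A, g (A.posSplitAt o))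
      + β * ((∑ o : DeformIdx A, g (A.negDeformAt o)) - ∑ o : DeformIdx A, g (A.posDeformAt o)))
  (hXM : ∀ (A B : LoopSeq d) (g : LoopSeq d → ℝ), XM A B g =
    (∑ i : Fin A.length, ∑ j : Fin B.length,
        ∑ q : {xy : Fin (A.get i).length × Fin (B.get j).length // ((B.get j).get xy.2).1 = ((A.get i).get xy.1).1},
          (g (A.take i ++ LoopSeq.prune [Word.negMerge _ q.1.1 _ q.1.2] ++ A.drop (i + 1) ++ B.eraseIdx j)
            - g (A.take i ++ LoopSeq.prune [Word.posMerge _ q.1.1 _ q.1.2] ++ A.drop (i + 1) ++ B.eraseIdx j)))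
    + ∑ j : Fin B.length, ∑ i : Fin A.length,
        ∑ q : {xy : Fin (B.get j).length × Fin (A.get i).length // ((A.get i).get xy.2).1 = ((B.get j).get xy.1).1},
          (g (A.eraseIdx i ++ (B.take j ++ LoopSeq.prune [Word.negMerge _ q.1.1 _ q.1.2] ++ B.drop (j + 1)))
            - g (A.eraseIdx i ++ (B.take j ++ LoopSeq.prune [Word.posMerge _ q.1.1 _ q.1.2] ++ B.drop (j + 1)))))
include hCc hLc hF0 hF1 hrec hperm hnil hbd hβ hP hG0 hGs hSD hXM

/-- ★ The leading-order equation with its pair source: for `m ≤ K` centered blocks (genuine, nonempty) and genuine `B₀`,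
`(|B₀| + Σ|C_j|) u_m − 𝕊𝔻_{B₀} u_m − Σ_j 𝕊𝔻_{C_j} u_m = Σ_{j<j'} u_{m−2}(B₀; C's without j, j') · XM C_j C_{j'} f₀`, where
`u_m(B₀; Cs) = coeff_m G(B₀; Cs)`. [new (lane)] -/
theorem centered_coeff_leading_equation (m : ℕ) (hm : m ≤ K) (B₀ : LoopSeq d) (Cs : List (LoopSeq d))
    (hB₀ : IsLoopSeq B₀) (hCs' : ∀ C ∈ Cs, IsLoopSeq C ∧ C ≠ []) (hlen : Cs.length = m) :
    ((B₀.len + (Cs.map LoopSeq.len).sum : ℕ) : ℝ) * coeff m (G B₀ Cs)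
        - SD B₀ (fun A => coeff m (G A Cs)) - ∑ j : Fin Cs.length, SD (Cs.get j) (fun C' => coeff m (G B₀ (Cs.set j C'))) =
      ∑ j : Fin Cs.length, ∑ j' : Fin Cs.length, if (j : ℕ) < j' then
        coeff (m - 2) (G B₀ ((Cs.eraseIdx j').eraseIdx j)) * XM (Cs.get j) (Cs.get j') (fun M => F 2 β M) else 0 := by
  -- the two other real block operators
  obtain ⟨TW, hTW⟩ : ∃ TW : LoopSeq d → (LoopSeq d → ℝ) → ℝ, ∀ A g, TW A g =
      (∑ o : SameIdx A, g (A.negTwistAt o)) - ∑ o : InvIdx A, g (A.posTwistAt o) := ⟨fun A g => _, fun _ _ => rfl⟩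
  obtain ⟨ME, hME⟩ : ∃ ME : LoopSeq d → (LoopSeq d → ℝ) → ℝ, ∀ A g, ME A g =
      (∑ o : MergeIdx A, g (A.negMergeAt o)) - ∑ o : MergeIdx A, g (A.posMergeAt o) := ⟨fun A g => _, fun _ _ => rfl⟩
  have TW0 : ∀ A, TW A (fun _ => 0) = 0 := fun A => by rw [hTW]; simp
  have ME0 : ∀ A, ME A (fun _ => 0) = 0 := fun A => by rw [hME]; simp
  have XM0 : ∀ A B, XM A B (fun _ => 0) = 0 := fun A B => by rw [hXM]; simp
  have hvan := centered_coeff_vanish hCc hLc hF0 hF1 hrec hperm hnil hbd hβ P hP hG0 hGs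
  have hCs : ∀ C ∈ Cs, IsLoopSeq C := fun C hC => (hCs' C hC).1
  have E := centered_equation_coeff hF0 hF1 hrec hperm P hP hG0 hGs SD TW ME XM hSD hTW hME hXM m hm Cs hCs' B₀ hB₀
  -- order `m - 1`: nothing survives
  have R1 : (if m = 0 then (0 : ℝ) else
      (((B₀.len + (Cs.map LoopSeq.len).sum : ℕ) : ℝ) * coeff (m - 1) (G B₀ Cs) + TW B₀ (fun A => coeff (m - 1) (G A Cs))
        + ∑ j : Fin Cs.length, TW (Cs.get j) (fun C' => coeff (m - 1) (G B₀ (Cs.set j C'))))) = 0 := by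
    split_ifs with hm0
    · rfl
    rw [hvan (m - 1) (by omega) B₀ Cs hB₀ hCs (by omega), mul_zero, zero_add,
      TW_congr_gen TW hTW hB₀ (g' := fun _ => 0) (fun A hA => hvan (m - 1) (by omega) A Cs hA hCs (by omega)), TW0,
      zero_add]
    refine Finset.sum_eq_zero fun j _ => ?_
    rw [TW_congr_gen TW hTW (hCs _ (List.get_mem Cs j)) (g' := fun _ => 0) (fun C' hC' =>
      hvan (m - 1) (by omega) B₀ _ hB₀ (forall_mem_set hCs hC' j) (by rw [List.length_set]; omega)), TW0]
  -- order `m - 2`: only the pair source survives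
  have R2 : (if m < 2 then (0 : ℝ) else
      (ME B₀ (fun A => coeff (m - 2) (G A Cs))
        + (∑ j : Fin Cs.length, ME (Cs.get j) (fun C' => coeff (m - 2) (G B₀ (Cs.set j C'))))
        + (∑ j : Fin Cs.length, XM B₀ (Cs.get j) (fun M => coeff (m - 2) (G M (Cs.eraseIdx j))))
        + ∑ j : Fin Cs.length, ∑ j' : Fin Cs.length, if (j : ℕ) < j' then
            XM (Cs.get j) (Cs.get j') (fun M => coeff (m - 2) (G B₀ ((Cs.set j M).eraseIdx j'))
              + ∑ q ∈ antidiagonal (m - 2), F (q.1 + 2) β M * coeff q.2 (G B₀ ((Cs.eraseIdx j').eraseIdx j)))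
          else 0)) =
      ∑ j : Fin Cs.length, ∑ j' : Fin Cs.length, if (j : ℕ) < j' then
        coeff (m - 2) (G B₀ ((Cs.eraseIdx j').eraseIdx j)) * XM (Cs.get j) (Cs.get j') (fun M => F 2 β M) else 0 := by
    split_ifs with hm2
    · -- fewer than two blocks: no pairs
      symm
      refine Finset.sum_eq_zero fun j _ => Finset.sum_eq_zero fun j' _ => ?_
      have hj := j.isLt
      have hj' := j'.isLt
      split_ifs with hjj
      · exfalso; omega
      · rfl
    have t1 : ME B₀ (fun A => coeff (m - 2) (G A Cs)) = 0 := by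
      rw [ME_congr_gen ME hME hB₀ (g' := fun _ => 0) (fun A hA => hvan (m - 2) (by omega) A Cs hA hCs (by omega)), ME0]
    have t2 : (∑ j : Fin Cs.length, ME (Cs.get j) (fun C' => coeff (m - 2) (G B₀ (Cs.set j C')))) = 0 :=
      Finset.sum_eq_zero fun j _ => by
        rw [ME_congr_gen ME hME (hCs _ (List.get_mem Cs j)) (g' := fun _ => 0) (fun C' hC' =>
          hvan (m - 2) (by omega) B₀ _ hB₀ (forall_mem_set hCs hC' j) (by rw [List.length_set]; omega)), ME0]
    have t3 : (∑ j : Fin Cs.length, XM B₀ (Cs.get j) (fun M => coeff (m - 2) (G M (Cs.eraseIdx j)))) = 0 :=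
      Finset.sum_eq_zero fun j _ => by
        rw [XM_congr_gen XM hXM hB₀ (hCs _ (List.get_mem Cs j)) (g' := fun _ => 0) (fun M hM =>
          hvan (m - 2) (by omega) M _ hM (forall_mem_eraseIdx hCs j)
            (by rw [List.length_eraseIdx_of_lt j.isLt]; omega)), XM0]
    rw [t1, t2, t3, zero_add, zero_add, zero_add]
    refine Finset.sum_congr rfl fun j _ => Finset.sum_congr rfl fun j' _ => ?_
    split_ifs with hjj
    · have hj' := j'.isLt
      have hlen2 : ((Cs.eraseIdx j').eraseIdx j).length = m - 2 := by
        rw [List.length_eraseIdx_of_lt (by rw [List.length_eraseIdx_of_lt hj']; omega), List.length_eraseIdx_of_lt hj']; omega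
      rw [XM_congr_gen XM hXM (hCs _ (List.get_mem Cs j)) (hCs _ (List.get_mem Cs j'))
        (g' := fun M => coeff (m - 2) (G B₀ ((Cs.eraseIdx j').eraseIdx j)) * F 2 β M) (fun M hM => ?_), XM_mul_left XM hXM]
      rw [hvan (m - 2) (by omega) B₀ _ hB₀ (forall_mem_eraseIdx (forall_mem_set hCs hM j) j')
        (by rw [List.length_eraseIdx_of_lt (by rw [List.length_set]; exact hj'), List.length_set]; omega), zero_add,
        Finset.sum_eq_single (0, m - 2)]
      · rw [mul_comm]
      · intro q hq hne
        have hq' : q.1 + q.2 = m - 2 := Finset.HasAntidiagonal.mem_antidiagonal.mp hq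
        have hq2 : q.2 < m - 2 := by
          rcases Nat.lt_or_ge q.2 (m - 2) with h | h
          · exact h
          · exfalso; exact hne (by ext <;> simp <;> omega)
        rw [hvan q.2 (by omega) B₀ _ hB₀ (forall_mem_eraseIdx (forall_mem_eraseIdx hCs j') j) (by rw [hlen2]; exact hq2),
          mul_zero]
      · intro h; exact absurd (Finset.HasAntidiagonal.mem_antidiagonal.mpr (by simp)) h
    · rfl
  rw [R1, R2, zero_add] at E
  exact E

/-- The `m = 2`, `B₀ = ∅` case: `(|A| + |B|) κ̃(A,B) − 𝕊𝔻_A κ̃(·,B) − 𝕊𝔻_B κ̃(A,·) = XM A B f₀` for the limiting block covariance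
`κ̃(A, B) = coeff₂ G(∅; A, B)` of genuine nonempty `A`, `B` (`K ≥ 2`). [new (lane)] -/
theorem centered_two_block_identity (hK : 2 ≤ K) (A B : LoopSeq d) (hA : IsLoopSeq A) (hB : IsLoopSeq B)
    (hA0 : A ≠ []) (hB0 : B ≠ []) :
    ((A.len : ℝ) * coeff 2 (G [] [A, B]) - SD A (fun C' => coeff 2 (G [] [C', B])))
      + ((B.len : ℝ) * coeff 2 (G [] [A, B]) - SD B (fun C' => coeff 2 (G [] [A, C']))) =
      XM A B (fun M => F 2 β M) := by
  have hnilS : IsLoopSeq ([] : LoopSeq d) := fun l hl => by simp at hl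
  have hCs' : ∀ C ∈ [A, B], IsLoopSeq C ∧ C ≠ [] := by
    intro C hC
    simp only [List.mem_cons, List.mem_nil_iff, or_false] at hC
    rcases hC with rfl | rfl
    · exact ⟨hA, hA0⟩
    · exact ⟨hB, hB0⟩
  have E := centered_coeff_leading_equation hCc hLc hF0 hF1 hrec hperm hnil hbd hβ P hP hG0 hGs SD XM hSD hXM 2 hK [] [A, B]
    hnilS hCs' rfl
  have hSDnil : SD [] (fun A' => coeff 2 (G A' [A, B])) = 0 := by
    rw [hSD]
    obtain ⟨h1, h2, h3, -⟩ := sums_nil (d := d) (R := ℝ)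
    rw [h1, h2, h3, h3]; ring
  have h00 : coeff 0 (G [] ([] : List (LoopSeq d))) = 1 := by rw [hG0, hP, hnil 0 (by omega), if_pos rfl]
  have e1 : ([A, B].eraseIdx 1).eraseIdx 0 = ([] : List (LoopSeq d)) := rfl
  have e2 : ∀ C' : LoopSeq d, [A, B].set 0 C' = [C', B] := fun _ => rfl
  have e3 : ∀ C' : LoopSeq d, [A, B].set 1 C' = [A, C'] := fun _ => rfl
  have g0 : ∀ h, ([A, B] : List (LoopSeq d)).get ⟨0, h⟩ = A := fun _ => rfl
  have g1 : ∀ h, ([A, B] : List (LoopSeq d)).get ⟨1, h⟩ = B := fun _ => rfl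
  simp only [sum_fin_pair, lt_irrefl, if_false, Nat.zero_lt_one, if_true, Nat.not_lt_zero, add_zero,
    hSDnil, sub_zero, List.map_cons, List.map_nil, List.sum_cons, List.sum_nil, LoopSeq.len_nil, Nat.cast_add,
    zero_add, g0, g1, e1, e2, e3, h00, one_mul] at E
  linarith [E]

end setting

end StringDuality

end Summit.QuantumFields.GaugeBoot

end
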